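import Literature.AlgebraicGeometry.Motives.CompleteIntersection
import Literature.AlgebraicGeometry.Motives.Cycles
import HarnessLib

/-!
# Hirschowitz–Iyer: `CH₁ ⊗ ℚ` of the `(2,3)` complete intersections in `ℙ⁸` (named fact)

A. Hirschowitz, J. N. Iyer, *Hilbert schemes of fat `r`-planes and the triviality of Chow groups of
complete intersections*, in: Vector bundles and complex geometry, Contemp. Math. **522** (2010)
53–70 = arXiv:0903.5018 [HirschowitzIyer2010]; read from the held arXiv text
(`paper:arxiv-0903.5018`, §§1.1–1.8, 2, 4, 5, 6). Base field algebraically closed of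
characteristic `0` (§1.8); `QCH_r := CH_r ⊗ ℚ`.

Printed results used:
* **Surjectivity theorem** (§1.4, proved in §2 "Strong planes"): "If, in the subvariety
  `Y' ⊂ ℙⁿ`, the Cartier divisor `Y ∈ |𝒪_{Y'}(d)|` is covered by strong `r`-planes, then the
  restriction map `QCH_{r+1}(Y') → QCH_r(Y)` is onto." (An `r`-plane `L ⊂ Y` is *strong* w.r.t.
  `Y'` if some `(r+1)`-plane `L' ⊂ Y'` containing `L` has `L' ∩ Y` equal to `L` or to `L'`
  set-theoretically.)
* **Spannedness** (the proposition of §6, with the non-emptiness proposition of §5): for integers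
  `r ≥ 0`, `1 ≤ s ≤ n−r−1`, `2 ≤ d₁ ≤ … ≤ d_{s−1} < d_s` with `ρ + r ≥ n − s`,
  `ρ := (r+2)(n−r) − Σᵢ C(dᵢ+r+1, r+1)`, "if `Y ⊂ Y'` is ANY pair of type `(d₁,…,d_s)` in `ℙⁿ`,
  then `Y` is covered by strong `r`-planes" (a pair of type `(d₁,…,d_s)`: `Y'` a union of
  irreducible components of a complete intersection of type `(d₁,…,d_{s−1})`, `Y` a divisor of
  degree `d_s` in `Y'`; §5 proves the needed non-emptiness of the Hilbert scheme of `d_s`-fat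
  `r`-planes when `d_s ≥ 3` is the unique maximal degree).
* **Main theorem** (§1.6): under the same hypotheses, "if `QCH_{r+1}(Y')` is trivial, then so is
  `QCH_r(Y)`"; for `s = 2`, `d₁ < d₂` this reads `n ≥ max{ [C(d₁+r+1,r+1)+C(d₂+r+1,r+1)+r²+r−2]/(r+1),
  [C(d₁+r+2,r+2)+r²+3r]/(r+2) }`.

THE INSTANCE VENDORED HERE: `(n, r, s, (d₁,d₂)) = (8, 1, 2, (2,3))` — `ρ = 3·7 − (6+10) = 5`,
`ρ + r = 6 = n − s` (the boundary of the printed range; the displayed bound is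
`max{(6+10+0)/2, (10+4)/3} = 8 ≤ 8`), `d₂ = 3 ≥ 3` the unique maximum — applied to the pair
`Y = V₊(Q,C) ⊂ Y' = V₊(Q)` for a quadric `Q` and a cubic `C` on `ℙ⁸_ℂ` satisfying the Jacobian
condition (`IsNonsingularSystem`, so that `V₊(Q,C)` is the scheme-theoretic, smooth, complete
intersection — in particular the Cartier divisor of `C|_{V₊(Q)} ∈ |𝒪_{V₊(Q)}(3)|` — and `Q` has
rank `≥ 3`, `V₊(Q)` an integral quadric hypersurface): the surjection
`QCH₂(V₊(Q)) ↠ QCH₁(V₊(Q,C))` gives **`rank_ℚ CH₁(V₊(Q,C)) ≤ 1` whenever `rank_ℚ CH₂(V₊(Q)) ≤ 1`**.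
"Rank `≤ 1`" of an additive group `A` is rendered, as in route `HodgeConjecture/schlafli-minus-five`,
by `∀ a b : A, ∃ (m,n) ≠ (0,0), m•a = n•b`; with this rendering the hypothesis (rank `≤ 1`, which
includes `QCH₂(Y') = 0`) is weaker than HI's "trivial = one-dimensional" but the conclusion still
follows from the printed SURJECTIVITY theorem, so the fact is at most as strong as print.
Schemes are the tree's: `completeIntersection F` = `V₊(F)` with its reduced induced structure
(`Motives/CompleteIntersection.lean`), `ChowGroup X d` (`Motives/Cycles.lean`).

Why it matters (grounding note, not part of the fact): the hypothesis holds for every quadric of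
rank `≥ 3` in `ℙ⁸` (smooth `Q⁷`: cellular, `CH₂ = ℤ·[plane]`; cones: localisation sequence plus
the affine-bundle formula), so the fact yields `CH₁(X) ⊗ ℚ` of rank `≤ 1` for EVERY smooth
`(2,3)`-sixfold `X ⊂ ℙ⁸` — the thesis `Summit.HodgeConjecture.HodgeConjecture.Theses.SchlafliMinusFive.ChowOneVeryGeneral23`
(stated there only for very general `(Q,C)`), hence `LinesEquivalentVeryGeneral23` (with degree
invariance) and the conclusion of `ChowOneSpecialisation23`. CAVEAT recorded for reviewers and
refuters: Voisin, Ann. Sci. ÉNS 46 (2013) = arXiv:1107.2600, p. 3, lists Bloch's conjecture for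
coniveau-2 complete intersections as "essentially known only in the case `c = 1`" apart from
intersections of quadrics (Otwinowska) and small cubics (Collino), and neither that paper nor
Tian–Zong (Compositio 2014) cites Hirschowitz–Iyer; the result is nonetheless published in a
refereed AMS volume and is vendored as printed. What is NOT here: the general `(n, r, s, d)`
statement (needs linear subspaces, fat planes and restriction to Cartier divisors on possibly
singular `Y'`), the Chow groups of quadrics, Roitman's `CH₀`, and any Hodge-theoretic consequence.
-/

noncomputable section

namespace Literature.AlgebraicGeometry.Motives

open MvPolynomial

/-- **Hirschowitz–Iyer 2010, Main Theorem (§1.6) via the surjectivity theorem (§1.4/§2) and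
spannedness (§§5–6), at `(n, r, s, (d₁, d₂)) = (8, 1, 2, (2, 3))`.** For forms `Q` of degree `2`
and `C` of degree `3` in `ℂ[x₀,…,x₈]` satisfying the Jacobian condition `IsNonsingularSystem`
(so `Y := V₊(Q,C) ⊂ ℙ⁸_ℂ` is the smooth `6`-dimensional complete intersection, a cubic Cartier
divisor in the integral quadric `Y' := V₊(Q)`): if `CH₂(V₊(Q))` has `ℚ`-rank `≤ 1` then
`CH₁(V₊(Q,C))` has `ℚ`-rank `≤ 1` (printed: "`QCH₂(Y') → QCH₁(Y)` is onto", `Y` being covered by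
strong lines since `ρ + r = 6 ≥ n − s = 6`). Rank `≤ 1` is rendered as: any two classes satisfy a
non-trivial integral relation. Grounds `Summit.HodgeConjecture.HodgeConjecture.Theses.SchlafliMinusFive.ChowOneVeryGeneral23`
(item = fact ∘ [`CH₂` of a rank-`≥ 3` quadric in `ℙ⁸` has rank `1`] ∘ [the route's rendering of
`X ≅ V₊(Q,C)` ⇒ Jacobian condition]). [cite: HirschowitzIyer2010, Main Theorem of §1.6 via §1.4 and §6 (case n=8 r=1 s=2 degrees 2<3)] -/
def HirschowitzIyer2010_QCH1_quadricCubic_P8 : Prop :=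
  ∀ (Q C : MvPolynomial (Fin (8 + 1)) ℂ), Q.IsHomogeneous 2 → C.IsHomogeneous 3 →
    IsNonsingularSystem ℂ ![Q, C] →
    (∀ a b : ChowGroup (completeIntersection (fun _ : Fin 1 => Q)).left 2,
        ∃ m n : ℤ, (m ≠ 0 ∨ n ≠ 0) ∧ m • a = n • b) →
    ∀ a b : ChowGroup (completeIntersection ![Q, C]).left 1,
      ∃ m n : ℤ, (m ≠ 0 ∨ n ≠ 0) ∧ m • a = n • b

end Literature.AlgebraicGeometry.Motives

end
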